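import Literature.NumberTheory.LFunctions.WeilBlockRowsR
import Literature.Analysis.ValidatedNumerics.ExpPoly.Poly
import HarnessLib

/-!
# Two-prime certificates: the dominance rows of `R = S' − UᵀU` by LINEAR list traversals

Topic `Literature/NumberTheory/LFunctions` (kernel certificates of the Weil form, `WeilCert` format).  The row checks
`checkDomRowPZ` (`WeilBlockRowsPZ.lean`) compute the row `i` of `R` through INDEXED access `getM A k l = (A.getD k []).getD l 0`,
which costs `O(k + l)` kernel steps per access — `≈ 4·10⁶` cons traversals per row at `nb = 128`, about `80 s` of kernel
time, which exceeds the farm's per-`decide` budget (a re-check of the landed `WeilTwoPrimeOddMarginHRowsPZ0` row fails today).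
This file computes the SAME rational row by linear traversals (one column extraction, then `axpy` folds over the row lists
with the padded vector operations `Poly.add` / `Poly.smul` of `ExpPoly/Poly.lean`), `≈ 5·10⁴` steps per row:

* `axpyFold as rows = Σ_k a_k • row_k` (padded), `getD_axpyFold` — its entries;
* `WeilCert.dtpRowF`, `WeilCert.rRowF`, `WeilCert.checkDomRowF` — the fast row of `R` and its dominance check (the shape
  conditions `Pm.length = Dn.length = U.length = nb` are part of the check);
* `WeilCert.getV_rRowF_eq` — entrywise agreement with `rRowPZ`; `WeilCert.checkDomRowPZ_of_F` and the drop-in replacement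
  `WeilCert.checkDomRowG_of_F` of `checkDomRowG_of_PZ` for the certificate files.  [folklore]
-/

noncomputable section

open Finset
open scoped BigOperators

namespace Literature.NumberTheory.LFunctions

open Literature.Analysis.ValidatedNumerics.ExpPoly

/-! ## Padded vector operations on `List ℚ` and the `axpy` fold -/

/-- [folklore] -/
theorem getD_polyAdd : ∀ (p q : List ℚ) (j : ℕ), (Poly.add p q).getD j 0 = p.getD j 0 + q.getD j 0
  | [], q, j => by rw [Poly.add_nil_left, List.getD_nil, zero_add]
  | a :: p, [], j => by rw [Poly.add_nil_right, List.getD_nil, add_zero]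
  | a :: p, b :: q, 0 => by rw [Poly.add, List.getD_cons_zero, List.getD_cons_zero, List.getD_cons_zero]
  | a :: p, b :: q, j + 1 => by
      rw [Poly.add, List.getD_cons_succ, List.getD_cons_succ, List.getD_cons_succ, getD_polyAdd p q j]

/-- [folklore] -/
theorem getD_polySmul (c : ℚ) : ∀ (p : List ℚ) (j : ℕ), (Poly.smul c p).getD j 0 = c * p.getD j 0
  | [], j => by simp [Poly.smul]
  | a :: p, 0 => by simp [Poly.smul]
  | a :: p, j + 1 => by
      have := getD_polySmul c p j
      simp only [Poly.smul, List.map_cons, List.getD_cons_succ] at this ⊢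
      exact this

/-- `Σ_k a_k • row_k` over paired lists, as a padded list. [folklore] -/
def axpyFold : List ℚ → List (List ℚ) → List ℚ
  | a :: as, r :: rs => Poly.add (Poly.smul a r) (axpyFold as rs)
  | _, _ => []

/-- Entries of the `axpy` fold: `(Σ_k a_k • row_k)_j = Σ_{k < |rows|} a_k (row_k)_j` (missing scalars count as `0`). [folklore] -/
theorem getD_axpyFold : ∀ (as : List ℚ) (rs : List (List ℚ)) (j : ℕ),
    (axpyFold as rs).getD j 0 = ∑ k ∈ Finset.range rs.length, as.getD k 0 * (rs.getD k []).getD j 0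
  | [], [], j => by simp [axpyFold]
  | [], r :: rs, j => by simp [axpyFold]
  | a :: as, [], j => by simp [axpyFold]
  | a :: as, r :: rs, j => by
      rw [axpyFold, getD_polyAdd, getD_polySmul, getD_axpyFold as rs j, List.length_cons, Finset.sum_range_succ']
      simp only [List.getD_cons_succ, List.getD_cons_zero]
      ring

namespace WeilCert

variable (c : WeilCert)

/-! ## The fast row -/

/-- Column `i` of a matrix given by rows. [folklore] -/
def colOf (A : List (List ℚ)) (i : ℕ) : List ℚ := A.map fun row ↦ getV row i

/-- Fast row `i` of the unscaled `Dnᵀ Pm`: `w'_l = Σ_k Dn_{ki} Pm_{kl}`. [folklore] -/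
def dtpRowF (Pm Dn : List (List ℚ)) (i : ℕ) : List ℚ := axpyFold (colOf Dn i) Pm


/-- Fast row `i` of `R = S' − UᵀU` (same value as `rRowPZ`). [folklore] -/
def rRowF (Pm Dn : List (List ℚ)) (Ls : List ℚ) (Hp : List (List ℚ)) (κ : ℚ) (p i : ℕ) : List ℚ :=
  let w := dtpRowF Pm Dn i
  let t := axpyFold w Dn
  let u := axpyFold (colOf (c.Ub p) i) (c.Ub p)
  let hp := Hp.getD i []
  let li := getV Ls i
  let bi := c.bQ p i
  tabV c.nb fun j ↦
    (getV t j / (li * getV Ls j) + κ * ((if i = j then 2 * bi else 0) - bi * c.bQ p j * getV hp j)) - getV u j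

/-- Fast one-sided dominance of row `i`, with the shape conditions of the data. [folklore] -/
def checkDomRowF (Pm Dn : List (List ℚ)) (Ls : List ℚ) (Hp : List (List ℚ)) (κ : ℚ) (p i : ℕ) : Bool :=
  let r := c.rRowF Pm Dn Ls Hp κ p i
  decide (Pm.length = c.nb) && decide (Dn.length = c.nb) && decide ((c.Ub p).length = c.nb) &&
    decide ((sumR c.nb fun j ↦ if j = i then 0 else |getV r j|) ≤ getV r i)

variable {c}

/-- [folklore] -/
theorem getD_colOf (A : List (List ℚ)) (i k : ℕ) : (colOf A i).getD k 0 = getM A k i := by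
  unfold colOf getM getV
  rw [List.getD_eq_getElem?_getD, List.getElem?_map, List.getD_eq_getElem?_getD]
  cases h : A[k]? <;> simp [h]

/-- Entries of the fast `Dnᵀ Pm` row agree with `dtpRowPZ`. [folklore] -/
theorem getV_dtpRowF {Pm Dn : List (List ℚ)} (hPm : Pm.length = c.nb) (i : ℕ) {l : ℕ} (hl : l < c.nb) :
    getV (dtpRowF Pm Dn i) l = getV (c.dtpRowPZ Pm Dn i) l := by
  unfold dtpRowF dtpRowPZ
  rw [getV_tabV _ hl, sumR_eq_sum]
  unfold getV
  rw [getD_axpyFold, hPm]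
  refine Finset.sum_congr rfl fun k _ ↦ ?_
  rw [getD_colOf]
  rfl

/-- **The fast row agrees with `rRowPZ` entrywise.** [folklore] -/
theorem getV_rRowF_eq {Pm Dn : List (List ℚ)} {Ls : List ℚ} {Hp : List (List ℚ)} (hPm : Pm.length = c.nb)
    (hDn : Dn.length = c.nb) {p : ℕ} (hUp : (c.Ub p).length = c.nb) (κ : ℚ) (i : ℕ) {j : ℕ} (hj : j < c.nb) :
    getV (c.rRowF Pm Dn Ls Hp κ p i) j = getV (c.rRowPZ Pm Dn Ls Hp κ p i) j := by
  unfold rRowF rRowPZ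
  dsimp only
  rw [getV_tabV _ hj, getV_tabV _ hj]
  have ht : getV (axpyFold (dtpRowF Pm Dn i) Dn) j = sumR c.nb fun l ↦ getV (c.dtpRowPZ Pm Dn i) l * getM Dn l j := by
    unfold getV
    rw [getD_axpyFold, hDn, sumR_eq_sum]
    refine Finset.sum_congr rfl fun l hl ↦ ?_
    have := getV_dtpRowF (c := c) (Dn := Dn) hPm i (Finset.mem_range.1 hl)
    unfold getV at this
    rw [this]
    rfl
  have hu : getV (axpyFold (colOf (c.Ub p) i) (c.Ub p)) j = sumR c.nb fun k ↦ getM (c.Ub p) k i * getM (c.Ub p) k j := by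
    unfold getV
    rw [getD_axpyFold, hUp, sumR_eq_sum]
    refine Finset.sum_congr rfl fun k _ ↦ ?_
    rw [getD_colOf]
    rfl
  have hhp : getV (Hp.getD i []) j = getM Hp i j := rfl
  rw [ht, hu, hhp]

/-- **`checkDomRowPZ` from the fast check** (same proposition, cheaper evaluation). [folklore] -/
theorem checkDomRowPZ_of_F {Pm Dn : List (List ℚ)} {Ls : List ℚ} {Hp : List (List ℚ)} {κ : ℚ} {p i : ℕ} (hi : i < c.nb)
    (h : c.checkDomRowF Pm Dn Ls Hp κ p i = true) : c.checkDomRowPZ Pm Dn Ls Hp κ p i = true := by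
  unfold checkDomRowF at h
  simp only [Bool.and_eq_true, decide_eq_true_eq] at h
  obtain ⟨⟨⟨hPm, hDn⟩, hU⟩, hdom⟩ := h
  unfold checkDomRowPZ
  dsimp only
  rw [decide_eq_true_eq, sumR_eq_sum]
  rw [sumR_eq_sum, getV_rRowF_eq hPm hDn hU κ i hi] at hdom
  refine le_trans (le_of_eq ?_) hdom
  refine Finset.sum_congr rfl fun j hj ↦ ?_
  by_cases hji : j = i
  · rw [if_pos hji, if_pos hji]
  · rw [if_neg hji, if_neg hji, getV_rRowF_eq hPm hDn hU κ i (Finset.mem_range.1 hj)]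

/-- **`checkDomRowG` from the fast factored-data check** (drop-in replacement of `checkDomRowG_of_PZ`). [folklore] -/
theorem checkDomRowG_of_F {P : ℕ → ℕ → ℚ} {Pm Dn : List (List ℚ)} {Ls : List ℚ} {Hp : List (List ℚ)} {κ : ℚ}
    {p i : ℕ} (hi : i < c.nb)
    (hPm : ∀ k < c.nb, c.checkPmRowG P Pm p k = true) (hDn : ∀ k < c.nb, c.checkDnRow Dn Ls p k = true)
    (hHp : ∀ i < c.nb, c.checkHpRow Hp p i = true) (h : c.checkDomRowF Pm Dn Ls Hp κ p i = true) :
    c.checkDomRowG P κ p i = true :=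
  checkDomRowG_of_PZ hi hPm hDn hHp (checkDomRowPZ_of_F hi h)

/-! ## The Bessel-block claim rows `Hp = C H Cᵀ` by linear traversals -/

/-- `Σ_{k<|row|} row_k · f (k₀ + k)` by structural recursion on the row. [folklore] -/
def dotIdx (f : ℕ → ℚ) : List ℚ → ℕ → ℚ
  | [], _ => 0
  | a :: row, k₀ => a * f k₀ + dotIdx f row (k₀ + 1)

/-- [folklore] -/
theorem dotIdx_eq (f : ℕ → ℚ) : ∀ (row : List ℚ) (k₀ : ℕ),
    dotIdx f row k₀ = ∑ k ∈ Finset.range row.length, row.getD k 0 * f (k₀ + k)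
  | [], k₀ => by simp [dotIdx]
  | a :: row, k₀ => by
      rw [dotIdx, dotIdx_eq f row (k₀ + 1), List.length_cons, Finset.sum_range_succ']
      simp only [List.getD_cons_succ, List.getD_cons_zero, add_zero, add_comm, add_left_comm]

/-- `Σ_{l<|a|,|b|} a_l b_l` (dot product of two lists, truncating). [folklore] -/
def dotL : List ℚ → List ℚ → ℚ
  | a :: as, b :: bs => a * b + dotL as bs
  | _, _ => 0

/-- [folklore] -/
theorem dotL_eq : ∀ (as bs : List ℚ), bs.length ≤ as.length →
    dotL as bs = ∑ l ∈ Finset.range bs.length, as.getD l 0 * bs.getD l 0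
  | [], [], _ => by simp [dotL]
  | [], b :: bs, h => by simp at h
  | a :: as, [], _ => by simp [dotL]
  | a :: as, b :: bs, h => by
      rw [dotL, dotL_eq as bs (by simpa using h), List.length_cons, Finset.sum_range_succ']
      simp only [List.getD_cons_succ, List.getD_cons_zero, add_comm]

/-- Fast row `i` of `C H`: `ch_l = Σ_k C_{ik} H_{kl}` for `l < nb`. [folklore] -/
def chRowF (p i : ℕ) : List ℚ :=
  let crow := (c.Cb p).getD i []
  tabV c.nb fun l ↦ dotIdx (fun k ↦ c.hBlkQ p k l) crow 0

/-- Fast claim row `i` of `Hp = C H Cᵀ`: `Hp_{ij} = Σ_l ch_l C_{jl}` for all `j < nb`, with shape conditions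
(`nb` rows of `C`, each of length `nb`; row `i` of `Hp` has length `nb`). [folklore] -/
def checkHpRowF (Hp : List (List ℚ)) (p i : ℕ) : Bool :=
  let ch := c.chRowF p i
  let hrow := Hp.getD i []
  decide ((c.Cb p).length = c.nb) && (c.Cb p).all (fun row ↦ row.length == c.nb) && decide (hrow.length = c.nb) &&
    (List.zipWith (fun hij crow ↦ decide (hij = dotL ch crow)) hrow (c.Cb p)).all id

/-- [folklore] -/
theorem getV_chRowF {p : ℕ} (hC : ∀ row ∈ c.Cb p, row.length = c.nb) (hlen : (c.Cb p).length = c.nb) (i : ℕ) {l : ℕ}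
    (hl : l < c.nb) : getV (c.chRowF p i) l = getV (c.chRow p i) l := by
  unfold chRowF chRow
  rw [getV_tabV _ hl, getV_tabV _ hl, dotIdx_eq, sumR_eq_sum]
  by_cases hi : i < c.nb
  · have hrow : ((c.Cb p).getD i []).length = c.nb := by
      rw [List.getD_eq_getElem?_getD, List.getElem?_eq_getElem (by rw [hlen]; exact hi)]
      exact hC _ (List.getElem_mem _)
    rw [hrow]
    refine Finset.sum_congr rfl fun k _ ↦ ?_
    simp only [zero_add, getM]
  · -- row beyond the matrix: both sides vanish
    have hrow : (c.Cb p).getD i [] = [] := by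
      rw [List.getD_eq_getElem?_getD, List.getElem?_eq_none (by rw [hlen]; omega)]; rfl
    rw [hrow]
    simp only [List.length_nil, Finset.range_zero, Finset.sum_empty]
    symm
    refine Finset.sum_eq_zero fun k _ ↦ ?_
    rw [show getM (c.Cb p) i k = 0 from by unfold getM; rw [hrow]; rfl, zero_mul]

/-- **`checkHpRow` from the fast check.** [folklore] -/
theorem checkHpRow_of_F {Hp : List (List ℚ)} {p i : ℕ} (h : c.checkHpRowF Hp p i = true) :
    c.checkHpRow Hp p i = true := by
  unfold checkHpRowF at h
  simp only [Bool.and_eq_true, decide_eq_true_eq, List.all_eq_true, beq_iff_eq] at h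
  obtain ⟨⟨⟨hlen, hC⟩, hHlen⟩, hall⟩ := h
  unfold checkHpRow
  refine WeilCert2.allBelow_of_forall fun j hj ↦ ?_
  rw [decide_eq_true_eq]
  -- entry `j` of the zipWith
  have hjC : j < (c.Cb p).length := by rw [hlen]; exact hj
  have hjH : j < (Hp.getD i []).length := by rw [hHlen]; exact hj
  have hjH' : j < (Hp[i]?.getD []).length := by rwa [List.getD_eq_getElem?_getD] at hjH
  have hz := hall (decide ((Hp.getD i [])[j] = dotL (c.chRowF p i) ((c.Cb p)[j]))) (by
    rw [List.mem_iff_getElem]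
    refine ⟨j, by simp [List.length_zipWith, hjC, hjH'], ?_⟩
    simp [List.getElem_zipWith])
  simp only [id, decide_eq_true_eq] at hz
  have hCj : ((c.Cb p)[j]).length = c.nb := hC _ (List.getElem_mem _)
  have hchlen : c.nb ≤ (c.chRowF p i).length := by unfold chRowF; simp [tabV]
  rw [dotL_eq _ _ (by rw [hCj]; exact hchlen), hCj] at hz
  have e1 : getM Hp i j = (Hp.getD i [])[j] := by
    simp only [getM, List.getD_eq_getElem?_getD]
    rw [List.getElem?_eq_getElem hjH', Option.getD_some]
  rw [e1, hz, sumR_eq_sum]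
  refine Finset.sum_congr rfl fun l hl ↦ ?_
  have hl' := Finset.mem_range.1 hl
  rw [← getV_chRowF hC hlen i hl']
  simp only [getV, getM, List.getD_eq_getElem?_getD, List.getElem?_eq_getElem hjC, Option.getD_some]

/-! ## The same with TRIANGULAR storage of the Legendre block (rows of length `≤ nb`) -/

/-- A sum over `range n` of terms vanishing beyond `m ≤ n` is the sum over `range m`. [folklore] -/
theorem sum_range_of_zero_beyond {m n : ℕ} (hmn : m ≤ n) (f : ℕ → ℚ) (hf : ∀ l, m ≤ l → f l = 0) :
    ∑ l ∈ Finset.range n, f l = ∑ l ∈ Finset.range m, f l := by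
  symm
  refine Finset.sum_subset (Finset.range_subset_range.2 hmn) fun l hl hlm ↦ hf l ?_
  simp only [Finset.mem_range, not_lt] at hl hlm; exact hlm

/-- Fast claim row `i` of `Hp = C H Cᵀ` for a Legendre block stored with rows of length `≤ nb` (triangular storage):
`Hp_{ij} = Σ_l ch_l C_{jl}` for all `j < nb`. [folklore] -/
def checkHpRowT (Hp : List (List ℚ)) (p i : ℕ) : Bool :=
  let ch := c.chRowF p i
  let hrow := Hp.getD i []
  decide ((c.Cb p).length = c.nb) && (c.Cb p).all (fun row ↦ decide (row.length ≤ c.nb)) && decide (hrow.length = c.nb) &&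
    (List.zipWith (fun hij crow ↦ decide (hij = dotL ch crow)) hrow (c.Cb p)).all id

/-- Entries of the fast `C H` row, triangular storage. [folklore] -/
theorem getV_chRowF_tri {p : ℕ} (hC : ∀ row ∈ c.Cb p, row.length ≤ c.nb) (hlen : (c.Cb p).length = c.nb) (i : ℕ) {l : ℕ}
    (hl : l < c.nb) : getV (c.chRowF p i) l = getV (c.chRow p i) l := by
  unfold chRowF chRow
  rw [getV_tabV _ hl, getV_tabV _ hl, dotIdx_eq, sumR_eq_sum]
  have hrowle : ((c.Cb p).getD i []).length ≤ c.nb := by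
    by_cases hi : i < c.nb
    · rw [List.getD_eq_getElem?_getD, List.getElem?_eq_getElem (by rw [hlen]; exact hi)]
      exact hC _ (List.getElem_mem _)
    · rw [List.getD_eq_getElem?_getD, List.getElem?_eq_none (by rw [hlen]; omega)]; simp
  rw [sum_range_of_zero_beyond hrowle _ (fun k hk ↦ by
    rw [show getM (c.Cb p) i k = 0 from by
      unfold getM; rw [List.getD_eq_getElem?_getD (l := (c.Cb p).getD i []), List.getElem?_eq_none hk]; rfl, zero_mul])]
  refine Finset.sum_congr rfl fun k _ ↦ ?_
  simp only [zero_add, getM]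

/-- **`checkHpRow` from the fast triangular-storage check.** [folklore] -/
theorem checkHpRow_of_T {Hp : List (List ℚ)} {p i : ℕ} (h : c.checkHpRowT Hp p i = true) :
    c.checkHpRow Hp p i = true := by
  unfold checkHpRowT at h
  simp only [Bool.and_eq_true, decide_eq_true_eq, List.all_eq_true] at h
  obtain ⟨⟨⟨hlen, hC⟩, hHlen⟩, hall⟩ := h
  unfold checkHpRow
  refine WeilCert2.allBelow_of_forall fun j hj ↦ ?_
  rw [decide_eq_true_eq]
  have hjC : j < (c.Cb p).length := by rw [hlen]; exact hj
  have hjH' : j < (Hp[i]?.getD []).length := by rw [← List.getD_eq_getElem?_getD, hHlen]; exact hj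
  have hz := hall (decide ((Hp.getD i [])[j]'(by rwa [List.getD_eq_getElem?_getD]) = dotL (c.chRowF p i) ((c.Cb p)[j])))
    (by
      rw [List.mem_iff_getElem]
      refine ⟨j, by simp [List.length_zipWith, hjC, hjH'], ?_⟩
      simp [List.getElem_zipWith])
  simp only [id, decide_eq_true_eq] at hz
  have hCj : ((c.Cb p)[j]).length ≤ c.nb := hC _ (List.getElem_mem _)
  have hchlen : (c.chRowF p i).length = c.nb := by unfold chRowF; simp [tabV]
  rw [dotL_eq _ _ (by rw [hchlen]; exact hCj)] at hz
  have e1 : getM Hp i j = (Hp.getD i [])[j]'(by rwa [List.getD_eq_getElem?_getD]) := by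
    simp only [getM, List.getD_eq_getElem?_getD]
    rw [List.getElem?_eq_getElem hjH', Option.getD_some]
  rw [e1, hz, sumR_eq_sum]
  rw [sum_range_of_zero_beyond hCj _ (fun l hl ↦ by
    rw [show getM (c.Cb p) j l = 0 from by
      unfold getM
      rw [List.getD_eq_getElem?_getD (l := c.Cb p), List.getElem?_eq_getElem hjC, Option.getD_some, List.getD_eq_getElem?_getD,
        List.getElem?_eq_none hl]; rfl, mul_zero])]
  refine Finset.sum_congr rfl fun l hl ↦ ?_
  have hl' : l < c.nb := lt_of_lt_of_le (Finset.mem_range.1 hl) hCj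
  rw [← getV_chRowF_tri hC hlen i hl']
  simp only [getV, getM, List.getD_eq_getElem?_getD, List.getElem?_eq_getElem hjC, Option.getD_some]

end WeilCert

end Literature.NumberTheory.LFunctions
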